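import Mathlib
import Literature.NumberTheory.LFunctions.Zhang2022.Section7ZetaZeroFreeWide
import Literature.NumberTheory.LFunctions.Zhang2022.Section7ZetaNearOne
import Literature.NumberTheory.LFunctions.RHInvZetaBound
import HarnessLib

/-!
# Zhang (2022), §7 part (c): under (A), `1/ζ(s) ≪ 𝓛⁹` on the shifted contour of (7.19)

Topic `Literature/NumberTheory/LFunctions/Zhang2022` (Landau–Siegel audit tree; verdict-neutral).
Y. Zhang, *Discrete mean estimates and the Landau–Siegel zero*, arXiv:2211.02515v1 (2022)
[Zhang2022LandauSiegel] — **an unrefereed manuscript under adjudication.** Cell siegel-zhang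
(D-0069). §7 p. 40 (tex L2108–L2121) moves the contour of (7.19) to `σ = 1 − 𝓛⁻¹, |t| ≤ D` (plus
far and horizontal pieces) and asserts, "by Lemma 5.2 (i) and standard estimates", an error
`O(pkε₁/l₂)` (node `Z22:§7.u049`). The integrand carries `ζ(s)⁻¹`; at depth `𝓛⁻¹` below `σ = 1`
and height up to `D = e^𝓛` the classical zero-free region supplies neither `ζ ≠ 0` (gap row
G-adj2-3; the width-`𝓛⁻¹` presupposition was discharged under (A) by
`Section7dStatements.zeta_ne_zero_of_assumptionA`, p413466) nor a size bound for `ζ⁻¹`. This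
THEOREM-ONLY file supplies both in the manuscript's own framework (Assumption (A)):

* (companion `Section7ZetaZeroFreeWide.lean`, `zeta_ne_zero_wide`) under (A), for `D` large:
  `ζ(s) ≠ 0` for `Re s > 1 − 2𝓛⁻¹`, `|Im s| ≤ 2D` (Deuring–Heilbronn);
* `norm_ge_of_ratio_le` — **Borel–Carathéodory, lower-bound form**: `F` holomorphic, zero-free on
  `‖w − c‖ < R` with `‖F w‖ ≤ Q‖F c‖` ⇒ `‖F z‖ ≥ ‖F c‖·exp(−2(log Q + 1)‖z−c‖/(R−‖z−c‖))`
  (Mathlib's `Complex.borelCaratheodory_zero` applied to a branch of `log(F/F(c))`, tree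
  `InvZetaRH.exists_log_of_ball`);
* `norm_inv_zeta_le_pow_nine` — **under (A), for `D` large: `‖ζ(s)⁻¹‖ ≤ C𝓛⁹` for every `s ≠ 1`
  with `1 − 𝓛⁻¹ ≤ Re s ≤ 1 + 𝓛⁻¹`, `|Im s| ≤ D`** (absolute `C`): the previous item for `ζ₁ = (s−1)ζ`
  on the disc of radius `3𝓛⁻¹` about `1 + 𝓛⁻¹ + it`, zero-free by the first item, with ratio
  `Q = O(𝓛²)` from Titchmarsh's Theorem 3.5 at depth `2𝓛⁻¹ ≤ 4/log|Im w|`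
  (`ZetaNearOne.norm_riemannZeta_le_exp_mul_log`) and `|ζ(1+𝓛⁻¹+it)| ≥ (𝓛+1)⁻¹`; at distance
  `2𝓛⁻¹` the loss `e^{4(log Q + 1)}` is POLYNOMIAL in `𝓛` — which is why the Deuring–Heilbronn width
  (`≍ 𝓛⁻¹·const` here, in truth `≍ log 𝓛/𝓛`) suffices where a classical Landau-type estimate would not.

WHAT THIS IS NOT: any statement about Theorems 1–2 of the manuscript or about Landau–Siegel zeros;
not the contour bound of `Z22:§7.u049` itself (companion `Section7ContourBound.lean`), only its
`ζ`-inputs; CONDITIONAL on (A) exactly as every §§5–18 node of the manuscript.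

## References

* Y. Zhang, arXiv:2211.02515v1 (2022), §7 p. 40, tex L2108–L2121; §5 Lemma 5.5.
  [cite: Zhang2022LandauSiegel, §7 p.40]
* E. Bombieri, *Le grand crible dans la théorie analytique des nombres*, Astérisque 18 (1987), §6
  Thm. 14 (Deuring–Heilbronn; tree `deuring_heilbronn_holds`). [cite: Bombieri1987GrandCrible, §6 Thm. 14]
* H. L. Montgomery, R. C. Vaughan, *Multiplicative Number Theory I* (2007), Ch. 6, Lemma 6.2
  (Borel–Carathéodory). [cite: MontgomeryVaughan2007, Ch. 6, Lemma 6.2]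
-/

noncomputable section

open Complex Real Metric Set

namespace Literature.NumberTheory.LFunctions.Zhang2022.ZetaLowerBound


/-- For every `L₀` there is `D₀` with `𝓛 = log D ≥ max(L₀, 2)` for all `D ≥ D₀`. [folklore] -/
private theorem exists_nat_ell_ge' (L₀ : ℝ) :
    ∃ D₀ : ℕ, ∀ D : ℕ, D₀ ≤ D → L₀ ≤ Skeleton.ell D ∧ 2 ≤ Skeleton.ell D := by
  refine ⟨⌈Real.exp (max L₀ 2)⌉₊, fun D hD => ?_⟩
  unfold Skeleton.ell
  have h1 : Real.exp (max L₀ 2) ≤ D := (Nat.le_ceil _).trans (by exact_mod_cast hD)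
  have h2 := Real.log_le_log (Real.exp_pos _) h1
  rw [Real.log_exp] at h2
  exact ⟨(le_max_left _ _).trans h2, (le_max_right _ _).trans h2⟩

/-! ### §1. A Borel–Carathéodory lower bound from a ratio bound -/

/-- **Borel–Carathéodory, lower-bound form.** If `F` is holomorphic and zero-free on the disc
`‖w − c‖ < R` and `‖F w‖ ≤ Q‖F c‖` there (`Q ≥ 1`), then for `‖z − c‖ < R`,
`‖F z‖ ≥ ‖F c‖ · exp(−2(log Q + 1)‖z − c‖/(R − ‖z − c‖))`: apply Mathlib's
`Complex.borelCaratheodory_zero` to a branch of `log(F/F(c))` (tree `InvZetaRH.exists_log_of_ball`),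
whose real part is `log‖F‖ − log‖F c‖ ≤ log Q`. [cite: MontgomeryVaughan2007, Ch. 6, Lemma 6.2] -/
theorem norm_ge_of_ratio_le {F : ℂ → ℂ} {c : ℂ} {R Q : ℝ} (hR : 0 < R) (hQ : 1 ≤ Q)
    (hF : DifferentiableOn ℂ F (ball c R)) (hF0 : ∀ w ∈ ball c R, F w ≠ 0)
    (hratio : ∀ w ∈ ball c R, ‖F w‖ ≤ Q * ‖F c‖) {z : ℂ} (hz : z ∈ ball c R) :
    ‖F c‖ * Real.exp (-(2 * (Real.log Q + 1) * ‖z - c‖ / (R - ‖z - c‖))) ≤ ‖F z‖ := by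
  obtain ⟨Lf, hLd, -, -, hexp⟩ := InvZetaRH.exists_log_of_ball hR hF hF0
  have hreL : ∀ w ∈ ball c R, (Lf w).re = Real.log ‖F w‖ := fun w hw => by
    rw [← hexp w hw, Complex.norm_exp, Real.log_exp]
  have hcmem : c ∈ ball c R := mem_ball_self hR
  have hFc : 0 < ‖F c‖ := norm_pos_iff.mpr (hF0 c hcmem)
  set M : ℝ := Real.log Q + 1 with hM
  have hM0 : 0 < M := by have := Real.log_nonneg hQ; linarith
  set g : ℂ → ℂ := fun u => Lf (c + u) - Lf c with hg
  have hmaps : MapsTo (fun u : ℂ => c + u) (ball 0 R) (ball c R) := by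
    intro u hu; simpa [mem_ball, dist_eq_norm] using hu
  have hgd : DifferentiableOn ℂ g (ball 0 R) :=
    (hLd.comp ((differentiableOn_const c).add differentiableOn_id) hmaps).sub
      (differentiableOn_const _)
  have hgre : MapsTo g (ball 0 R) {z | z.re ≤ M} := by
    intro u hu
    have hcu : c + u ∈ ball c R := hmaps hu
    simp only [Set.mem_setOf_eq, hg, Complex.sub_re, hreL _ hcu, hreL _ hcmem]
    have h1 : Real.log ‖F (c + u)‖ ≤ Real.log (Q * ‖F c‖) :=
      Real.log_le_log (norm_pos_iff.mpr (hF0 _ hcu)) (hratio _ hcu)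
    rw [Real.log_mul (by positivity) hFc.ne'] at h1
    linarith
  have hg0 : g 0 = 0 := by show Lf (c + 0) - Lf c = 0; rw [add_zero, sub_self]
  have hzc : z - c ∈ ball (0 : ℂ) R := by
    rw [mem_ball_zero_iff]; rwa [mem_ball, dist_eq_norm] at hz
  have hBC := Complex.borelCaratheodory_zero hM0 hgd hgre hR hzc hg0
  have hgz : g (z - c) = Lf z - Lf c := by
    show Lf (c + (z - c)) - Lf c = Lf z - Lf c; rw [add_sub_cancel]
  -- `Re g(z − c) ≥ −‖g(z − c)‖`
  have hlow : Real.log ‖F c‖ - 2 * M * ‖z - c‖ / (R - ‖z - c‖) ≤ Real.log ‖F z‖ := by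
    have h1 : -(2 * M * ‖z - c‖ / (R - ‖z - c‖)) ≤ (g (z - c)).re := by
      have := neg_le_abs (g (z - c)).re
      have := abs_re_le_norm (g (z - c))
      linarith
    rw [hgz, Complex.sub_re, hreL z hz, hreL c hcmem] at h1
    linarith
  have h := Real.exp_le_exp.mpr hlow
  rw [Real.exp_sub, Real.exp_log hFc, Real.exp_log (norm_pos_iff.mpr (hF0 z hz)),
    div_eq_mul_inv, ← Real.exp_neg] at h
  convert h using 3

/-! ### §2. `1/ζ(s) ≪ 𝓛⁹` on the shifted contour of (7.19), under (A) -/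

/-- Real and imaginary parts in a ball: `|Re(w − c)|, |Im(w − c)| < R`. [folklore] -/
private theorem re_im_of_mem_ball {w c : ℂ} {R : ℝ} (hw : w ∈ ball c R) :
    |w.re - c.re| < R ∧ |w.im - c.im| < R := by
  rw [mem_ball, dist_eq_norm] at hw
  exact ⟨(abs_re_le_norm (w - c)).trans_lt (by simpa using hw),
    (abs_im_le_norm (w - c)).trans_lt (by simpa using hw)⟩

/-- The far case of the ratio bound: for `|t| > 4` and `w` in the disc (`|Im w − t| < 1`,
`Re w > 1 − 2ℓ⁻¹ ≥ 1/2`, `|Im w| ≤ D²`, `ℓ = log D ≥ 4`), Titchmarsh 3.5 at depth `4/log|Im w|`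
gives `‖ζ₁ w‖ ≤ 64e⁴ℓ·‖c − 1‖` once `‖w − 1‖ ≤ 4‖c − 1‖`. [cite: Titchmarsh1986, Thm. 3.5] -/
private theorem norm_zeta1_le_far {w c : ℂ} {t ℓ : ℝ} {D : ℕ} (hℓ4 : 4 ≤ ℓ)
    (hℓlog : ℓ = Real.log D) (hD3 : (3 : ℝ) ≤ D) (ht4 : 4 < |t|) (hw4 : |w.im - t| < 1)
    (hw1 : 1 - 2 * ℓ⁻¹ < w.re) (hw3 : |w.im| ≤ 2 * D) (hw1n : ‖w - 1‖ ≤ 4 * ‖c - 1‖) :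
    ‖riemannZeta₁ w‖ ≤ 64 * Real.exp 4 * ℓ * ‖c - 1‖ := by
  have hℓ0 : 0 < ℓ := by linarith
  have hℓinv : ℓ⁻¹ ≤ 1 / 4 := by
    have h4 : ℓ⁻¹ ≤ (4 : ℝ)⁻¹ := (inv_le_inv₀ hℓ0 (by norm_num)).mpr hℓ4
    have e4 : (4 : ℝ)⁻¹ = 1 / 4 := by norm_num
    linarith [h4, e4]
  have hwim3 : 3 ≤ |w.im| := by
    have := abs_lt.mp hw4
    rcases le_or_gt 0 t with h0 | h0
    · rw [abs_of_nonneg h0] at ht4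
      rw [abs_of_nonneg (by linarith)]; linarith
    · rw [abs_of_neg h0] at ht4
      rw [abs_of_nonpos (by linarith)]; linarith
  have hwne1 : w ≠ 1 := by
    intro h; rw [h, Complex.one_im, abs_zero] at hwim3; linarith
  have hD2 : |w.im| ≤ (D : ℝ) ^ 2 := le_trans hw3 (by nlinarith)
  have hlogw : Real.log |w.im| ≤ 2 * ℓ := by
    calc Real.log |w.im| ≤ Real.log ((D : ℝ) ^ 2) := Real.log_le_log (by linarith) hD2
      _ = 2 * ℓ := by rw [Real.log_pow, hℓlog]; norm_num
  have hlogw0 : 0 < Real.log |w.im| := Real.log_pos (by linarith)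
  have hdepth : 1 - 4 / Real.log |w.im| ≤ w.re := by
    have : 2 * ℓ⁻¹ ≤ 4 / Real.log |w.im| := by
      rw [show 2 * ℓ⁻¹ = 4 / (2 * ℓ) by field_simp; ring]
      exact div_le_div_of_nonneg_left (by norm_num) hlogw0 hlogw
    linarith
  have hζw := ZetaNearOne.norm_riemannZeta_le_exp_mul_log (s := w) (A := 4) (by norm_num)
    hwim3 (by linarith) hdepth
  rw [riemannZeta₁_eq_mul hwne1, norm_mul]
  calc ‖w - 1‖ * ‖riemannZeta w‖ ≤ (4 * ‖c - 1‖) * (8 * Real.exp 4 * Real.log |w.im|) :=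
        mul_le_mul hw1n hζw (norm_nonneg _) (by positivity)
    _ ≤ (4 * ‖c - 1‖) * (8 * Real.exp 4 * (2 * ℓ)) := by gcongr
    _ = 64 * Real.exp 4 * ℓ * ‖c - 1‖ := by ring

/-- The disc of the Borel–Carathéodory argument: centre `c = 1 + ℓ⁻¹ + it`, radius `R = 3ℓ⁻¹`.
If `ζ ≠ 0` on `Re s > 1 − 2ℓ⁻¹, |Im s| ≤ 2D`, then on the disc `ζ₁ ≠ 0` and
`‖ζ₁ w‖ ≤ 64e⁴M₁ℓ(ℓ+1)·‖ζ₁ c‖` (`M₁` = the bound for `ζ₁` on `[0,2]×[−5,5]`); moreover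
`ℓ⁻¹ ≤ ‖c − 1‖` and `‖c − 1‖/(1+ℓ) ≤ ‖ζ₁ c‖`. [cite: Titchmarsh1986, Thm. 3.5] -/
private theorem disc_facts {ℓ t : ℝ} {D : ℕ} (hℓ4 : 4 ≤ ℓ) (hℓlog : ℓ = Real.log D)
    (hD3 : (3 : ℝ) ≤ D) (ht : |t| ≤ D) {c : ℂ} (hcre : c.re = 1 + ℓ⁻¹) (hcim : c.im = t)
    (hzfD : ∀ s : ℂ, 1 - 2 * ℓ⁻¹ < s.re → |s.im| ≤ 2 * (D : ℝ) → riemannZeta s ≠ 0)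
    {M₁ : ℝ} (hM₁1 : 1 ≤ M₁)
    (hM₁ : ∀ s : ℂ, 0 ≤ s.re → s.re ≤ 2 → |s.im| ≤ 5 → ‖riemannZeta₁ s‖ ≤ M₁) :
    (∀ w ∈ ball c (3 * ℓ⁻¹), riemannZeta₁ w ≠ 0) ∧
    (∀ w ∈ ball c (3 * ℓ⁻¹), ‖riemannZeta₁ w‖ ≤ (64 * Real.exp 4 * M₁ * ℓ * (ℓ + 1)) * ‖riemannZeta₁ c‖) ∧
    ℓ⁻¹ ≤ ‖c - 1‖ ∧ ‖c - 1‖ * (1 / (1 + ℓ)) ≤ ‖riemannZeta₁ c‖ := by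
  have hℓ0 : 0 < ℓ := by linarith
  have hℓinv : ℓ⁻¹ ≤ 1 / 4 := by
    have h4 : ℓ⁻¹ ≤ (4 : ℝ)⁻¹ := (inv_le_inv₀ hℓ0 (by norm_num)).mpr hℓ4
    have e4 : (4 : ℝ)⁻¹ = 1 / 4 := by norm_num
    linarith [h4, e4]
  have hℓinv0 : 0 < ℓ⁻¹ := inv_pos.mpr hℓ0
  have hE1 : 1 ≤ Real.exp 4 := Real.one_le_exp (by norm_num)
  set R : ℝ := 3 * ℓ⁻¹ with hRdef
  have hR1 : R ≤ 1 := by linarith only [hRdef, hℓinv]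
  have hc1 : c ≠ 1 := by
    intro h; have := congrArg Complex.re h; rw [hcre, Complex.one_re] at this; linarith
  have hcn : ℓ⁻¹ ≤ ‖c - 1‖ := by
    have := abs_re_le_norm (c - 1)
    rw [Complex.sub_re, hcre, Complex.one_re, show 1 + ℓ⁻¹ - 1 = ℓ⁻¹ by ring,
      abs_of_pos hℓinv0] at this
    exact this
  -- points of the disc
  have hball : ∀ w ∈ ball c R,
      1 - 2 * ℓ⁻¹ < w.re ∧ w.re ≤ 2 ∧ |w.im| ≤ 2 * D ∧ |w.im - t| < R ∧ ‖w - c‖ < R := by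
    intro w hw
    obtain ⟨h1, h2⟩ := re_im_of_mem_ball hw
    rw [hcre] at h1; rw [hcim] at h2
    have h1' := abs_lt.mp h1
    have hwc : ‖w - c‖ < R := by rwa [mem_ball, dist_eq_norm] at hw
    refine ⟨by linarith only [hRdef, h1'.1], by linarith only [hRdef, h1'.2, hℓinv], ?_, h2, hwc⟩
    have h2' := abs_lt.mp h2
    have : |w.im| ≤ |t| + R := by
      rcases le_or_gt 0 w.im with hw0 | hw0
      · rw [abs_of_nonneg hw0]; linarith only [le_abs_self t, h2'.2]
      · rw [abs_of_neg hw0]; linarith only [neg_abs_le t, h2'.1]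
    linarith only [this, hR1, ht, hD3]
  -- zero-free
  have hζ₁ne : ∀ w ∈ ball c R, riemannZeta₁ w ≠ 0 := by
    intro w hw
    by_cases hw1 : w = 1
    · rw [hw1, riemannZeta₁_one]; exact one_ne_zero
    · rw [Ne, riemannZeta₁_eq_zero_iff hw1]
      obtain ⟨h1, -, h3, -⟩ := hball w hw
      exact hzfD w h1 h3
  -- `|ζ(c)| ≥ 1/(ℓ+1)`
  have hζc : 1 / (1 + ℓ) ≤ ‖riemannZeta c‖ := by
    have h := ZetaNearOne.norm_inv_riemannZeta_le_of_re (s := c) hℓinv0 (by rw [hcre])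
    rw [one_div, inv_inv] at h
    have hζc0 : riemannZeta c ≠ 0 := riemannZeta_ne_zero_of_one_lt_re (by rw [hcre]; linarith)
    rw [norm_inv] at h
    have h' := inv_le_of_inv_le₀ (norm_pos_iff.mpr hζc0) h
    simpa only [one_div] using h'
  have hζ₁c : riemannZeta₁ c = (c - 1) * riemannZeta c := riemannZeta₁_eq_mul hc1
  have hζ₁c_ge : ‖c - 1‖ * (1 / (1 + ℓ)) ≤ ‖riemannZeta₁ c‖ := by
    rw [hζ₁c, norm_mul]; exact mul_le_mul_of_nonneg_left hζc (norm_nonneg _)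
  refine ⟨hζ₁ne, fun w hw => ?_, hcn, hζ₁c_ge⟩
  obtain ⟨hw1, hw2, hw3, hw4, hwc⟩ := hball w hw
  by_cases ht4 : |t| ≤ 4
  · -- near the real axis: compactness bound for `ζ₁`
    have hwim : |w.im| ≤ 5 := by
      have := abs_lt.mp hw4
      rcases le_or_gt 0 w.im with h0 | h0
      · rw [abs_of_nonneg h0]; linarith only [(abs_le.mp ht4).2, this.2, hR1]
      · rw [abs_of_neg h0]; linarith only [(abs_le.mp ht4).1, this.1, hR1]
    have hb := hM₁ w (by linarith only [hw1, hℓinv]) hw2 hwim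
    have h1ℓ : (1 + ℓ) ≠ 0 := by linarith
    calc ‖riemannZeta₁ w‖ ≤ M₁ := hb
      _ = (M₁ * ℓ * (1 + ℓ)) * (ℓ⁻¹ * (1 / (1 + ℓ))) := by field_simp
      _ ≤ (64 * Real.exp 4 * M₁ * ℓ * (ℓ + 1)) * (‖c - 1‖ * (1 / (1 + ℓ))) := by
          apply mul_le_mul _ _ (by positivity) (by positivity)
          · rw [add_comm 1 ℓ]
            have h64 : M₁ ≤ 64 * Real.exp 4 * M₁ := by nlinarith
            exact mul_le_mul_of_nonneg_right (mul_le_mul_of_nonneg_right h64 hℓ0.le)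
              (by linarith)
          · exact mul_le_mul_of_nonneg_right hcn (by positivity)
      _ ≤ _ := mul_le_mul_of_nonneg_left hζ₁c_ge (by positivity)
  · -- far from the real axis
    push Not at ht4
    have hw1n : ‖w - 1‖ ≤ 4 * ‖c - 1‖ := by
      calc ‖w - 1‖ = ‖(w - c) + (c - 1)‖ := by ring_nf
        _ ≤ ‖w - c‖ + ‖c - 1‖ := norm_add_le _ _
        _ ≤ R + ‖c - 1‖ := by linarith only [hwc]
        _ ≤ 3 * ‖c - 1‖ + ‖c - 1‖ := by linarith only [hRdef, hcn]
        _ = 4 * ‖c - 1‖ := by ring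
    have hfar := norm_zeta1_le_far hℓ4 hℓlog hD3 ht4 (lt_of_lt_of_le hw4 hR1) hw1 hw3 hw1n
    have h1ℓ : (1 + ℓ) ≠ 0 := by linarith
    calc ‖riemannZeta₁ w‖ ≤ 64 * Real.exp 4 * ℓ * ‖c - 1‖ := hfar
      _ = (64 * Real.exp 4 * ℓ * (1 + ℓ)) * (‖c - 1‖ * (1 / (1 + ℓ))) := by field_simp
      _ ≤ (64 * Real.exp 4 * M₁ * ℓ * (ℓ + 1)) * (‖c - 1‖ * (1 / (1 + ℓ))) := by
          apply mul_le_mul_of_nonneg_right _ (by positivity)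
          rw [add_comm 1 ℓ]
          have : 64 * Real.exp 4 * ℓ ≤ 64 * Real.exp 4 * M₁ * ℓ :=
            mul_le_mul_of_nonneg_right (le_mul_of_one_le_right (by positivity) hM₁1) hℓ0.le
          exact mul_le_mul_of_nonneg_right this (by linarith)
      _ ≤ _ := mul_le_mul_of_nonneg_left hζ₁c_ge (by positivity)

/-- **`1/ζ(s) ≪ 𝓛⁹` on the shifted contour of (7.19), under (A).** For `D` large, `χ (mod D)` real
primitive with (A), and every `s ≠ 1` with `1 − 𝓛⁻¹ ≤ Re s ≤ 1 + 𝓛⁻¹`, `|Im s| ≤ D`: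
`‖ζ(s)⁻¹‖ ≤ C𝓛⁹` (an absolute `C`). Borel–Carathéodory (`norm_ge_of_ratio_le`) for `ζ₁ = (s−1)ζ`
on the disc of radius `3𝓛⁻¹` about `c = 1 + 𝓛⁻¹ + it` — zero-free by `zeta_ne_zero_wide` — with
ratio `Q = O(𝓛²)` (`disc_facts`); at distance `2𝓛⁻¹` the loss `e^{4(log Q+1)}` is polynomial in
`𝓛`. This is the "standard estimates" input of `Z22:§7.u049` at depth `𝓛⁻¹` (gap row G-adj2-3: not
supplied by the classical zero-free region), supplied under (A) by Deuring–Heilbronn.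
[cite: Zhang2022LandauSiegel, §7 p.40, tex L2118–L2121] -/
theorem norm_inv_zeta_le_pow_nine :
    ∃ C : ℝ, 0 < C ∧ Skeleton.ForAllLarge fun D _ χ => Skeleton.AssumptionA D χ →
      ∀ s : ℂ, s ≠ 1 → 1 - (Skeleton.ell D)⁻¹ ≤ s.re → s.re ≤ 1 + (Skeleton.ell D)⁻¹ →
        |s.im| ≤ (D : ℝ) → ‖(riemannZeta s)⁻¹‖ ≤ C * Skeleton.ell D ^ 9 := by
  obtain ⟨M₁, hM₁1, hM₁⟩ := ZetaNearOne.exists_bound_riemannZeta₁_rect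
  obtain ⟨D₀, hzf⟩ := zeta_ne_zero_wide
  obtain ⟨D₃, hD₃⟩ := exists_nat_ell_ge' 4
  obtain ⟨Q₀, hQ₀⟩ : ∃ Q₀ : ℝ, Q₀ = 64 * Real.exp 4 * M₁ := ⟨_, rfl⟩
  have hE1 : 1 ≤ Real.exp 4 := Real.one_le_exp (by norm_num)
  have hQ₀1 : 1 ≤ Q₀ := by rw [hQ₀]; nlinarith
  have hQ₀0 : 0 < Q₀ := by linarith
  refine ⟨7776 * Q₀ ^ 4, by positivity, max (max D₀ D₃) 3, ?_⟩
  intro D _ χ hD hq hprim hA s hs1 hσlo hσhi ht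
  have hD0' : D₀ ≤ D := (le_max_left _ _).trans ((le_max_left _ _).trans hD)
  have hD3' : D₃ ≤ D := (le_max_right _ _).trans ((le_max_left _ _).trans hD)
  have hD3 : 3 ≤ D := (le_max_right _ _).trans hD
  have hzfD := hzf D χ hD0' hq hprim hA
  obtain ⟨hℓ4, -⟩ := hD₃ D hD3'
  obtain ⟨ℓ, hℓdef⟩ : ∃ ℓ : ℝ, ℓ = Skeleton.ell D := ⟨_, rfl⟩
  rw [← hℓdef] at hℓ4 hσlo hσhi hzfD ⊢
  have hℓ0 : 0 < ℓ := by linarith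
  have hℓinv : ℓ⁻¹ ≤ 1 / 4 := by
    have h4 : ℓ⁻¹ ≤ (4 : ℝ)⁻¹ := (inv_le_inv₀ hℓ0 (by norm_num)).mpr hℓ4
    have e4 : (4 : ℝ)⁻¹ = 1 / 4 := by norm_num
    linarith [h4, e4]
  have hℓinv0 : 0 < ℓ⁻¹ := inv_pos.mpr hℓ0
  have hDr : (3 : ℝ) ≤ D := by exact_mod_cast hD3
  have hℓlog : ℓ = Real.log D := by rw [hℓdef]; rfl
  obtain ⟨t, htdef⟩ : ∃ t : ℝ, t = s.im := ⟨_, rfl⟩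
  rw [← htdef] at ht
  obtain ⟨c, hcdef⟩ : ∃ c : ℂ, c = ⟨1 + ℓ⁻¹, t⟩ := ⟨_, rfl⟩
  have hcre : c.re = 1 + ℓ⁻¹ := by rw [hcdef]
  have hcim : c.im = t := by rw [hcdef]
  obtain ⟨hζ₁ne, hratio, hcn, hζ₁c_ge⟩ :=
    disc_facts hℓ4 hℓlog hDr ht hcre hcim hzfD hM₁1 hM₁
  rw [← hQ₀] at hratio
  have hcn0 : 0 < ‖c - 1‖ := lt_of_lt_of_le hℓinv0 hcn
  have hR0 : 0 < 3 * ℓ⁻¹ := by positivity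
  obtain ⟨Q, hQ⟩ : ∃ Q : ℝ, Q = Q₀ * ℓ * (ℓ + 1) := ⟨_, rfl⟩
  rw [← hQ] at hratio
  have hQ1 : 1 ≤ Q := by
    rw [hQ]
    calc (1 : ℝ) = 1 * 1 * 1 := by ring
      _ ≤ Q₀ * ℓ * (ℓ + 1) := by gcongr <;> linarith
  -- the point `s`: `‖s − c‖ ≤ 2ℓ⁻¹ < R`
  have hscn : ‖s - c‖ ≤ 2 * ℓ⁻¹ := by
    have h := Complex.norm_le_abs_re_add_abs_im (s - c)
    rw [Complex.sub_re, Complex.sub_im, hcre, hcim, htdef, sub_self, abs_zero, add_zero] at h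
    refine h.trans (abs_le.mpr ⟨?_, ?_⟩) <;> linarith only [hσlo, hσhi]
  have hsmem : s ∈ ball c (3 * ℓ⁻¹) := by
    rw [mem_ball, dist_eq_norm]
    linarith only [hscn, hℓinv0]
  -- Borel–Carathéodory
  have hBC := norm_ge_of_ratio_le hR0 hQ1 (differentiable_riemannZeta₁.differentiableOn) hζ₁ne
    hratio hsmem
  have hexp4 : Real.exp (-(4 * (Real.log Q + 1))) ≤
      Real.exp (-(2 * (Real.log Q + 1) * ‖s - c‖ / (3 * ℓ⁻¹ - ‖s - c‖))) := by
    apply Real.exp_le_exp.mpr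
    apply neg_le_neg
    have hden0 : 0 < 3 * ℓ⁻¹ - ‖s - c‖ := by linarith only [hscn, hℓinv0]
    refine (div_le_iff₀ hden0).mpr ?_
    have hM0 : 0 ≤ Real.log Q + 1 := by have := Real.log_nonneg hQ1; linarith only [this]
    calc 2 * (Real.log Q + 1) * ‖s - c‖ ≤ 2 * (Real.log Q + 1) * (2 * ℓ⁻¹) := by gcongr
      _ = 4 * (Real.log Q + 1) * ℓ⁻¹ := by ring
      _ ≤ 4 * (Real.log Q + 1) * (3 * ℓ⁻¹ - ‖s - c‖) := by gcongr; linarith only [hscn]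
  have hζ₁s : ‖riemannZeta₁ c‖ * Real.exp (-(4 * (Real.log Q + 1))) ≤ ‖riemannZeta₁ s‖ :=
    le_trans (mul_le_mul_of_nonneg_left hexp4 (norm_nonneg _)) hBC
  have hexpM : Real.exp (4 * (Real.log Q + 1)) = (Real.exp 1 * Q) ^ 4 := by
    rw [show 4 * (Real.log Q + 1) = ((4 : ℕ) : ℝ) * (Real.log Q + 1) by norm_num,
      Real.exp_nat_mul, Real.exp_add, Real.exp_log (by linarith)]
    ring
  -- from `ζ₁` to `ζ`
  have hs1n : ‖s - 1‖ ≤ 3 * ‖c - 1‖ := by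
    calc ‖s - 1‖ = ‖(s - c) + (c - 1)‖ := by ring_nf
      _ ≤ ‖s - c‖ + ‖c - 1‖ := norm_add_le _ _
      _ ≤ 2 * ℓ⁻¹ + ‖c - 1‖ := by linarith only [hscn]
      _ ≤ 3 * ‖c - 1‖ := by linarith only [hcn]
  have hζs_pos : 0 < ‖riemannZeta s‖ := by
    have : riemannZeta₁ s ≠ 0 := hζ₁ne s hsmem
    rw [Ne, riemannZeta₁_eq_zero_iff hs1] at this
    exact norm_pos_iff.mpr this
  set E : ℝ := (Real.exp 1 * Q) ^ 4 with hEdef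
  have hE0 : 0 < E := by positivity
  have hkey : ‖c - 1‖ * (1 / (1 + ℓ)) ≤ 3 * ‖c - 1‖ * ‖riemannZeta s‖ * E := by
    have h1 : ‖riemannZeta₁ s‖ = ‖s - 1‖ * ‖riemannZeta s‖ := by
      rw [riemannZeta₁_eq_mul hs1, norm_mul]
    have h2 : ‖c - 1‖ * (1 / (1 + ℓ)) * Real.exp (-(4 * (Real.log Q + 1))) ≤
        3 * ‖c - 1‖ * ‖riemannZeta s‖ := by
      calc ‖c - 1‖ * (1 / (1 + ℓ)) * Real.exp (-(4 * (Real.log Q + 1)))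
          ≤ ‖riemannZeta₁ c‖ * Real.exp (-(4 * (Real.log Q + 1))) :=
            mul_le_mul_of_nonneg_right hζ₁c_ge (Real.exp_pos _).le
        _ ≤ ‖riemannZeta₁ s‖ := hζ₁s
        _ = ‖s - 1‖ * ‖riemannZeta s‖ := h1
        _ ≤ 3 * ‖c - 1‖ * ‖riemannZeta s‖ := mul_le_mul_of_nonneg_right hs1n hζs_pos.le
    rw [Real.exp_neg, hexpM] at h2
    have h3 := mul_le_mul_of_nonneg_right h2 hE0.le
    rwa [mul_assoc (‖c - 1‖ * (1 / (1 + ℓ))), inv_mul_cancel₀ hE0.ne', mul_one] at h3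
  have hkey' : 1 / (1 + ℓ) ≤ 3 * ‖riemannZeta s‖ * E := by
    have h' : ‖c - 1‖ * (1 / (1 + ℓ)) ≤ ‖c - 1‖ * (3 * ‖riemannZeta s‖ * E) := by
      calc ‖c - 1‖ * (1 / (1 + ℓ)) ≤ 3 * ‖c - 1‖ * ‖riemannZeta s‖ * E := hkey
        _ = ‖c - 1‖ * (3 * ‖riemannZeta s‖ * E) := by ring
    exact le_of_mul_le_mul_left h' hcn0
  have hmain : 1 ≤ 3 * (1 + ℓ) * E * ‖riemannZeta s‖ := by
    have h1ℓ : 0 < 1 + ℓ := by linarith only [hℓ0]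
    have h := mul_le_mul_of_nonneg_left hkey' h1ℓ.le
    rw [mul_one_div_cancel h1ℓ.ne'] at h
    calc (1 : ℝ) ≤ (1 + ℓ) * (3 * ‖riemannZeta s‖ * E) := h
      _ = 3 * (1 + ℓ) * E * ‖riemannZeta s‖ := by ring
  rw [norm_inv]
  have hfin : (‖riemannZeta s‖)⁻¹ ≤ 3 * (1 + ℓ) * E := by
    calc (‖riemannZeta s‖)⁻¹ = (‖riemannZeta s‖)⁻¹ * 1 := (mul_one _).symm
      _ ≤ (‖riemannZeta s‖)⁻¹ * (3 * (1 + ℓ) * E * ‖riemannZeta s‖) := by gcongr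
      _ = 3 * (1 + ℓ) * E := by field_simp
  refine hfin.trans ?_
  have he3 : Real.exp 1 ≤ 3 := by have := Real.exp_one_lt_d9; linarith only [this]
  have h2ℓ : 1 + ℓ ≤ 2 * ℓ := by linarith only [hℓ4]
  have h2ℓ' : ℓ + 1 ≤ 2 * ℓ := by linarith only [hℓ4]
  rw [hEdef, hQ]
  calc 3 * (1 + ℓ) * (Real.exp 1 * (Q₀ * ℓ * (ℓ + 1))) ^ 4
      ≤ 3 * (2 * ℓ) * (3 * (Q₀ * ℓ * (2 * ℓ))) ^ 4 := by gcongr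
    _ = 7776 * Q₀ ^ 4 * ℓ ^ 9 := by ring

end Literature.NumberTheory.LFunctions.Zhang2022.ZetaLowerBound
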